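import Literature.NumberTheory.Automorphic.Liu2021.Def411WeilCarriersLocalDataAtV
import Literature.NumberTheory.Automorphic.QuadraticLocalNormCompatibility
import HarnessLib

/-!
# [Liu 2021] Thm. 4.18 (2) «mutually non-isomorphic» from App. D Lemma D.1 (3) place by place — the `ε`- and `χ`-legs

Y. Liu, *Fourier–Jacobi cycles and arithmetic relative trace formula*, Camb. J. Math. **9** (2021) = arXiv:2102.11518 [Liu2021];
`FJcycle.tex` Thm. 4.18 (2) (l. 2241) with its printed proof «Statement (2) follows from Lemma D.1» (l. 2270), Def. 4.11 («`ω(μ,ε,χ) :=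
⊗'_v ω(μ_v,ε_v,χ_v)`», l. 2092–2096), Def. 4.12 (l. 2102–2108), App. D §D.1 Steps 1–3 (l. 5213–5224) and Lemma D.1 (3) (l. 5233:
«If `n ≥ 3`, then `ω(μ',ε',χ')` is isomorphic to `ω(μ,ε,χ)` if and only if `(μ',ε',χ')=(μ,ε,χ)`»).

The tree's ✔ `forall_localMu_eq_of_equiv_of_lemD1AsPrintedI` (`Def411WeilCarriersLocalDataAtV.lean` §6) runs the printed passage for the
`μ`-component only (what the END displays as `hμsep`).  This file supplies the two remaining components of the SAME local statement, so that the
full separation of the admissible triples — the `hsep` ∕ `hdist` clause «`ω_s ≃ ω_t` equivariantly and `ω_s ≠ 0` ⟹ `s = t`» consumed by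
✔ `Prop413Data.rank_intertwiningMap_rhoAt_le_one_of_asPrinted` (multiplicity one) — follows from [Lem. D.1 (1), (3)] AS PRINTED per place,
WITHOUT citing Thm. 4.18 (2):

* §1 the `ε`-leg at one place: Lemma D.1 (3)'s clause «`ε' = ε` in `E_v^{−×}/Nm E_v^×`» for the Step-1 representatives `(a·δ) ⊗ 1`, `(a'·δ) ⊗ 1`
  of two lines (`LemD1.SameClass (epsLine a v) (epsLine a' v)`) IS the equality of the `v`-components of the collections `locF a`, `locF a'`
  (`locF_apply_eq_of_sameClass_epsLine`: `x·(c ⊗ 1)x = ι_v(N x)` and `N(p + qδ) = p² − d q²`, tree `toLocalRing_algebraNorm` ∕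
  `algebraNorm_quadraticLocalEquiv`); hence over all `v` the collections coincide (`locF_eq_of_forall_sameClass_epsLine`); every `epsOf e`
  is global (`exists_locF_eq_epsOf`).
* §2 the `χ`-leg: the local component of a character `χ₁` of `E¹(𝔸_{F,f})` at a norm-one scalar does not depend on the `1 × 1` line presenting
  the centre (`coe_inclPlace_theta_eq`, `localCharOfCenter_theta_eq`), and a continuous `χ₁` is determined by its local components
  (`eq_of_forall_localCharOfCenter_eq`, `χ = ∏_v χ_v`); hence Lemma D.1 (3)'s `χ`-clause at every `v` gives `χ = χ'` in `Chi`
  (`chi_eq_of_forall_localCharOfCenter_theta_eq`).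
* §3 on the indexed family of the tree's local data (`localIndexedFamilyAtV`): the two clauses at one place from an equivalence of local types
  (`sameClass_and_chi_eq_of_nonempty_equiv_localTypes`), and the GLOBAL statement from a `G`-equivariant equivalence of two summands
  `ω(s_i,a_i,χ_i) ≃ ω(s_j,a_j,χ_j)`: `locF a_i = locF a_j ∧ χ_i = χ_j` (`locF_eq_and_chi_eq_of_equiv_of_lemD1AsPrintedI` — the displayed
  pair-form Lem. D.1 (1) input; `…AtV` — Lem. D.1 (1) read on the family).  With ✔ `forall_localMu_eq_of_equiv_of_lemD1AsPrintedI` + weak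
  approximation this is the full separation `s = t` (assembled Summits-side at the model's `uniformOmegaRep`).

Everything is a theorem over the tree's constructed carriers; no definition, no named fact, no `sorry`.  HC_CM is NOT mentioned further.
Seat prover-pub-hodgecm2-nothj-p3-g0-0 (pub-hodgecm2 «¬hJ» lane, sub-lemma M2a′), 2026-08-24.

## References
* [Liu2021] Thm. 4.18 (2) (l. 2241) and proof l. 2270; Def. 4.11, 4.12; App. D §D.1 Step 1 (l. 5217), Lemma D.1 (3) (l. 5233).
* [CasselsFrohlichANT1967] J. W. S. Cassels, A. Fröhlich (eds.), *Algebraic Number Theory*, Ch. II §11 (local norms).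
-/

set_option autoImplicit false

noncomputable section

open scoped Matrix Kronecker RestrictedProduct NumberField
open NumberField IsDedekindDomain
open Literature.NumberTheory Literature.NumberTheory.Automorphic Literature.NumberTheory.Automorphic.UnitaryGroup
open Literature.NumberTheory.GelbartRogawski1991 Literature.NumberTheory.GelbartRogawski1991.UnitaryDualPair
open Literature.NumberTheory.GelbartRogawski1991.UnitaryDualPair.WeilCoinv
open Literature.NumberTheory.Weil1964 Literature.RepresentationTheory
open Literature.NumberTheory.QuadraticForms (quadraticNormSubgroup)

namespace Literature.NumberTheory.Automorphic.Liu2021.Def411WeilCarriers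

variable (F E : Type) [Field F] [NumberField F] [Field E] [NumberField E] [Algebra F E]
variable (c : E ≃ₐ[F] E) (N : ℕ) (JV : Matrix (Fin N) (Fin N) E)
variable [Algebra.IsQuadraticExtension F E] {δ : E} (hcδ : c δ = -δ) (hδ : δ ≠ 0)

/-! ## §1 The `ε`-leg: Lemma D.1 (3)'s class clause at `v` is the `v`-component of the collection -/

section EpsLeg

omit [Algebra.IsQuadraticExtension F E] in
/-- The Step-1 representatives of two lines differ by the scalar `a'·a⁻¹ ⊗ 1`: `(a'·δ) ⊗ 1 = ι_v(a'/a) · ((a·δ) ⊗ 1)` in `E_v^×`.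
[cite: Liu2021, App. D §D.1 Step 1 (l. 5217)] -/
theorem epsLine_eq_mul (a a' : Fˣ) (v : HeightOneSpectrum (𝓞 F)) :
    epsLine E hδ a' v =
      Units.map (toLocalRing E v).toMonoidHom (Units.map (algebraMap F (v.adicCompletion F)).toMonoidHom (a' * a⁻¹)) *
        epsLine E hδ a v := by
  refine Units.ext ?_
  rw [Units.val_mul, coe_epsLine, coe_epsLine, Units.coe_map, Units.coe_map, RingHom.toMonoidHom_eq_coe,
    RingHom.toMonoidHom_eq_coe, MonoidHom.coe_coe, MonoidHom.coe_coe, IsDedekindDomain.HeightOneSpectrum.algebraMap_adicCompletion,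
    Function.comp_apply, Algebra.algebraMap_self_apply, toLocalRing_coe, ← map_mul]
  congr 1
  rw [Units.val_mul, Units.val_inv_eq_inv_val, map_mul, map_inv₀]
  field_simp

/-- **The `ε`-leg of [Liu2021, App. D Lemma D.1 (3)] at one place**: if the Step-1 representatives `(a·δ) ⊗ 1`, `(a'·δ) ⊗ 1` of the
lines `⟨a⟩`, `⟨a'⟩` lie in the same class of `E_v^{−×}/Nm_{E_v/F_v} E_v^×` (`LemD1.SameClass`, READING L3′: `(a'δ) ⊗ 1 = x·(c ⊗ 1)x·((aδ) ⊗ 1)`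
for a unit `x` of `E_v = E ⊗_F F_v`), then the `v`-components of the collections `locF a`, `locF a'` (classes in `F_v^×/Nm`, `Nm = {p² − d q²}`)
agree — `x·(c ⊗ 1)x = ι_v(N x)` (`toLocalRing_algebraNorm`) and `N(ι_v p + ι_v q·δ) = p² − d q²` (`algebraNorm_quadraticLocalEquiv`).
[cite: Liu2021, App. D Lemma D.1 (3) (l. 5233); Def. 4.12 (l. 2105)] [cite: CasselsFrohlichANT1967, Ch. II §11] -/
theorem locF_apply_eq_of_sameClass_epsLine {d : F} (hd : δ * δ = algebraMap F E d) (hN : 2 ≤ N) (hJh : (JV.map c)ᵀ = JV) (hJdet : JV.det ≠ 0)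
    (v : HeightOneSpectrum (𝓞 F)) (a a' : Fˣ)
    (h : LemD1.SameClass (S := LemD1OfPlace.standingData E v c N JV hcδ hδ hN hJh hJdet)
      ⟨epsLine E hδ a v, epsLine_mem_skew E c N JV hcδ hδ hN hJh hJdet a v⟩
      ⟨epsLine E hδ a' v, epsLine_mem_skew E c N JV hcδ hδ hN hJh hJdet a' v⟩) :
    locF F d a v = locF F d a' v := by
  obtain ⟨x, hx⟩ := h
  -- the quotient `a'/a ⊗ 1` is `x · (c ⊗ 1) x`
  set t : (v.adicCompletion F)ˣ := Units.map (algebraMap F (v.adicCompletion F)).toMonoidHom (a' * a⁻¹) with ht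
  have hunits : Units.map (toLocalRing E v).toMonoidHom t =
      x * Units.map ((LemD1OfPlace.standingData E v c N JV hcδ hδ hN hJh hJdet).σ : LocalRing E v →* LocalRing E v) x := by
    have h1 : Units.map (toLocalRing E v).toMonoidHom t * epsLine E hδ a v =
        x * Units.map ((LemD1OfPlace.standingData E v c N JV hcδ hδ hN hJh hJdet).σ : LocalRing E v →* LocalRing E v) x *
          epsLine E hδ a v := by
      rw [← epsLine_eq_mul F E hδ a a' v]
      exact hx
    exact mul_right_cancel h1
  have hval : toLocalRing E v (t : v.adicCompletion F) = (x : LocalRing E v) * conjLocal E c v x := by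
    have := congrArg Units.val hunits
    simpa [Units.coe_map, Literature.RepresentationTheory.Liu2021.OscillatorStandingData.σ_apply,
      LemD1OfPlace.standingData_conj_apply] using this
  -- hence `a'/a = N x = p² − d q²`
  rw [← toLocalRing_algebraNorm E v c hcδ hδ (x : LocalRing E v)] at hval
  have hnorm : (t : v.adicCompletion F) = Algebra.norm (v.adicCompletion F) (x : LocalRing E v) :=
    toLocalRing_injective E v hval
  obtain ⟨⟨p, q⟩, hpq⟩ := (quadraticLocalEquiv E v c hcδ hδ).surjective (x : LocalRing E v)
  rw [← hpq, algebraNorm_quadraticLocalEquiv E v c hcδ hδ hd] at hnorm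
  have hnorm' : (t : v.adicCompletion F) = p * p - algebraMap F (v.adicCompletion F) d * (q * q) := hnorm
  have hmem : t ∈ quadraticNormSubgroup (v.adicCompletion F) (algebraMap F (v.adicCompletion F) d) := by
    rw [Literature.NumberTheory.QuadraticForms.mem_quadraticNormSubgroup_iff]
    exact ⟨p, q, by rw [hnorm']; ring⟩
  -- the classes of `a` and `a'` agree
  rw [locF_apply, locF_apply, QuotientGroup.eq]
  have : (Units.map (algebraMap F (v.adicCompletion F)).toMonoidHom a)⁻¹ *
      Units.map (algebraMap F (v.adicCompletion F)).toMonoidHom a' = t := by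
    rw [ht, map_mul, map_inv, mul_comm]
  rw [this]
  exact hmem

/-- **The `ε`-leg globalised**: if at EVERY finite place the Step-1 representatives of `⟨a⟩` and `⟨a'⟩` lie in the same local class, the two
collections `(a·Nm E_v^×)_v`, `(a'·Nm E_v^×)_v` are EQUAL (a collection is the tuple of its components — Def. 4.11, second bullet).
[cite: Liu2021, Def. 4.11 (l. 2088), Def. 4.12 (l. 2105); App. D Lemma D.1 (3) (l. 5233)] -/
theorem locF_eq_of_forall_sameClass_epsLine {d : F} (hd : δ * δ = algebraMap F E d) (hN : 2 ≤ N) (hJh : (JV.map c)ᵀ = JV) (hJdet : JV.det ≠ 0) (a a' : Fˣ)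
    (h : ∀ v : HeightOneSpectrum (𝓞 F), LemD1.SameClass (S := LemD1OfPlace.standingData E v c N JV hcδ hδ hN hJh hJdet)
      ⟨epsLine E hδ a v, epsLine_mem_skew E c N JV hcδ hδ hN hJh hJdet a v⟩
      ⟨epsLine E hδ a' v, epsLine_mem_skew E c N JV hcδ hδ hN hJh hJdet a' v⟩) :
    locF F d a = locF F d a' :=
  funext fun v => locF_apply_eq_of_sameClass_epsLine F E c N JV hcδ hδ hd hN hJh hJdet v a a' (h v)

omit [NumberField E] [Algebra.IsQuadraticExtension F E] in
/-- **Every collection `epsOf e` is global**: `epsOf e = locF a` for some `a ∈ F^×` (by its definition, Def. 4.12's `(e · Nm E_v^×)_v` read as the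
classes of the `F`-part of `e/δ`, or the trivial collection) — so a faithful representative section `r` recovers it (`Rep.locF_toFun`).
[cite: Liu2021, Def. 4.12 (l. 2102–2108)] -/
theorem exists_locF_eq_epsOf (d : F) (δ₀ : E) (x : E) : ∃ a : Fˣ, locF F d a = epsOf F d E δ₀ x := by
  classical
  unfold epsOf
  split_ifs with h
  · exact ⟨1, map_one _⟩
  · exact ⟨_, rfl⟩

end EpsLeg

/-! ## §2 The `χ`-leg: local components of `χ ∈ Chi` at the centre do not depend on the line, and determine `χ` -/

section ChiLeg

/-- **Line-independence of the centre inclusion at `v`.**  For two `1 × 1` hermitian lines `J₁`, `J₁'` and a norm-one scalar `z ∈ E_v¹`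
(of the standing data at `v`), the finite-adèlic points `inclPlace v (θ_{J₁} z) ∈ U(J₁)(𝔸_{F,f})` and `inclPlace v (θ_{J₁'} z) ∈ U(J₁')(𝔸_{F,f})`
have THE SAME underlying matrix in `GL₁(𝔸_{E,f})` («`z` at the places over `v`, `1` elsewhere»): both regroup (`glRegroup`) to the same family
(`evalAt_inclPlace_of_over ∕ _of_not_over`, `coe_theta`). [cite: PlatonovRapinchuk1994, §5.1] -/
theorem coe_inclPlace_theta_eq (hN : 2 ≤ N) (hJh : (JV.map c)ᵀ = JV) (hJdet : JV.det ≠ 0) (v : HeightOneSpectrum (𝓞 F))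
    (J₁ J₁' : Matrix (Fin 1) (Fin 1) E) (z : (LemD1OfPlace.standingData E v c N JV hcδ hδ hN hJh hJdet).normOne) :
    ((inclPlace F E c 1 J₁ v (LemD1OfPlace.theta E v c N JV hcδ hδ hN hJh hJdet J₁ z) : finAdelic F E c 1 J₁) :
        GL (Fin 1) (FiniteAdeleRing (𝓞 E) E)) =
      ((inclPlace F E c 1 J₁' v (LemD1OfPlace.theta E v c N JV hcδ hδ hN hJh hJdet J₁' z) : finAdelic F E c 1 J₁') :
        GL (Fin 1) (FiniteAdeleRing (𝓞 E) E)) := by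
  apply (glRegroup F E 1).injective
  refine DFunLike.ext _ _ fun v' => funext fun w => ?_
  rw [glRegroup_apply_apply, glRegroup_apply_apply]
  by_cases hv : v' = v
  · subst hv
    rw [evalAt_inclPlace_of_over, evalAt_inclPlace_of_over, LemD1OfPlace.coe_theta, LemD1OfPlace.coe_theta]
  · rw [evalAt_inclPlace_of_not_over F E c 1 J₁ hv, evalAt_inclPlace_of_not_over F E c 1 J₁' hv]

/-- **The local component `χ_{1,v}(z)` of a character `χ₁` of `E¹(𝔸_{F,f})` at a norm-one scalar `z ∈ E_v¹` does not depend on the line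
`J₁` through which the centre is presented** (`localCharOfCenter … = χ₁ ∘ det ∘ inclPlace v`, `localCharOfCenter_eq_comp_inclPlace`, and the
previous lemma). [cite: TateThesis1967, §3.2 Lemma 3.2.1] -/
theorem localCharOfCenter_theta_eq (hN : 2 ≤ N) (hJh : (JV.map c)ᵀ = JV) (hJdet : JV.det ≠ 0) (v : HeightOneSpectrum (𝓞 F))
    (J₁ J₁' : Matrix (Fin 1) (Fin 1) E) (hJ₁ : J₁ 0 0 ≠ 0) (hJ₁' : J₁' 0 0 ≠ 0) (χ₁ : finAdelicOne F E c →* ℂˣ)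
    (z : (LemD1OfPlace.standingData E v c N JV hcδ hδ hN hJh hJdet).normOne) :
    localCharOfCenter F E c J₁ hJ₁ χ₁ v (LemD1OfPlace.theta E v c N JV hcδ hδ hN hJh hJdet J₁ z) =
      localCharOfCenter F E c J₁' hJ₁' χ₁ v (LemD1OfPlace.theta E v c N JV hcδ hδ hN hJh hJdet J₁' z) := by
  rw [localCharOfCenter_eq_comp_inclPlace, localCharOfCenter_eq_comp_inclPlace, MonoidHom.comp_apply, MonoidHom.comp_apply,
    MonoidHom.comp_apply, MonoidHom.comp_apply]
  have key : finAdelicCenterInv F E c J₁ hJ₁ (inclPlace F E c 1 J₁ v (LemD1OfPlace.theta E v c N JV hcδ hδ hN hJh hJdet J₁ z)) =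
      finAdelicCenterInv F E c J₁' hJ₁' (inclPlace F E c 1 J₁' v (LemD1OfPlace.theta E v c N JV hcδ hδ hN hJh hJdet J₁' z)) := by
    refine Subtype.ext ?_
    rw [coe_finAdelicCenterInv, coe_finAdelicCenterInv, coe_inclPlace_theta_eq F E c N JV hcδ hδ hN hJh hJdet v J₁ J₁' z]
  rw [key]

omit [Algebra.IsQuadraticExtension F E] in
/-- **A continuous character of `E¹(𝔸_{F,f})` is determined by its local components** (read at any one line `J₁`): if `χ_{1,v} = χ_{2,v}` for
every finite place `v` then `χ₁ = χ₂` — `χ = ∏_v χ_v` on `Πʳ_v [U(J₁)(F_v), U(J₁)(𝒪_v)]` (`coe_charOfCenter_eq_finprod`) and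
`E¹(𝔸_{F,f}) ↠ Πʳ_v U(J₁)(F_v)` (`charOfCenter_comp`). [cite: TateThesis1967, §3.2 Lemma 3.2.1] -/
theorem eq_of_forall_localCharOfCenter_eq (J₁ : Matrix (Fin 1) (Fin 1) E) (hJ₁ : J₁ 0 0 ≠ 0) {χ₁ χ₂ : finAdelicOne F E c →* ℂˣ}
    (hχ₁ : Continuous χ₁) (hχ₂ : Continuous χ₂)
    (h : ∀ v : HeightOneSpectrum (𝓞 F), localCharOfCenter F E c J₁ hJ₁ χ₁ v = localCharOfCenter F E c J₁ hJ₁ χ₂ v) : χ₁ = χ₂ := by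
  have key : charOfCenter F E c J₁ hJ₁ χ₁ = charOfCenter F E c J₁ hJ₁ χ₂ := by
    refine MonoidHom.ext fun g => Units.ext ?_
    rw [coe_charOfCenter_eq_finprod F E c J₁ hJ₁ hχ₁, coe_charOfCenter_eq_finprod F E c J₁ hJ₁ hχ₂]
    exact finprod_congr fun v => by rw [h v]
  rw [← charOfCenter_comp F E c J₁ hJ₁ χ₁, ← charOfCenter_comp F E c J₁ hJ₁ χ₂, key]

/-- **The `χ`-leg of [Liu2021, App. D Lemma D.1 (3)] globalised**: if at every finite place `v` the Step-3 characters `χ_v ∘ θ`, `χ'_v ∘ θ` of two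
triples — presented at their OWN lines `⟨a⟩`, `⟨a'⟩` (`localCharOfCenter … (JW a) … ∘ theta … (JW a)`) — agree on `E_v¹`, then `χ = χ'` in the
index type `Chi F E c` («`χ = ⊗ χ_v`», Def. 4.11 third bullet; `θ` onto, `theta_surjective`).
[cite: Liu2021, Def. 4.11 (l. 2090–2096); App. D §D.1 Step 3 (l. 5221), Lemma D.1 (3) (l. 5233)] [cite: TateThesis1967, §3.2 Lemma 3.2.1] -/
theorem chi_eq_of_forall_localCharOfCenter_theta_eq (hN : 2 ≤ N) (hJh : (JV.map c)ᵀ = JV) (hJdet : JV.det ≠ 0) (a a' : Fˣ)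
    (χ χ' : Chi F E c)
    (h : ∀ (v : HeightOneSpectrum (𝓞 F)) (z : (LemD1OfPlace.standingData E v c N JV hcδ hδ hN hJh hJdet).normOne),
      localCharOfCenter F E c (JW F E a) (JW_apply_ne_zero F E a) χ.1 v (LemD1OfPlace.theta E v c N JV hcδ hδ hN hJh hJdet (JW F E a) z) =
        localCharOfCenter F E c (JW F E a') (JW_apply_ne_zero F E a') χ'.1 v
          (LemD1OfPlace.theta E v c N JV hcδ hδ hN hJh hJdet (JW F E a') z)) :
    χ = χ' := by
  refine Subtype.ext (eq_of_forall_localCharOfCenter_eq F E c (JW F E a) (JW_apply_ne_zero F E a) χ.2.1 χ'.2.1 fun v => ?_)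
  refine MonoidHom.ext fun u => ?_
  obtain ⟨z, rfl⟩ := LemD1OfPlace.theta_surjective E v c N JV hcδ hδ hN hJh hJdet (JW F E a) (JW_apply_ne_zero F E a) u
  rw [h v z]
  exact localCharOfCenter_theta_eq F E c N JV hcδ hδ hN hJh hJdet v (JW F E a') (JW F E a) (JW_apply_ne_zero F E a')
    (JW_apply_ne_zero F E a) χ'.1 z

end ChiLeg

/-! ## §3 Lemma D.1 (3) per place on the indexed family: the `ε`- and `χ`-components of two equivalent summands agree -/

section Indexed

variable {n : ℕ} (e : Fin N × Fin 1 ≃ Fin n) {TV : Matrix (Fin N) (Fin N) F} {d : F} (hd : δ * δ = algebraMap F E d)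

omit [NumberField F] [NumberField E] [Algebra.IsQuadraticExtension F E] in
/-- `3 ≤ N` when `3 ≤ n` (`N = n` along `e`; plumbing). [folklore] -/
private theorem three_le_rank' (e : Fin N × Fin 1 ≃ Fin n) (hn : 3 ≤ n) : 3 ≤ N := by
  have := Fintype.card_congr e; simp only [Fintype.card_prod, Fintype.card_fin, mul_one] at this; omega

omit [NumberField F] [NumberField E] [Algebra.IsQuadraticExtension F E] in
/-- `2 ≤ N` when `3 ≤ n` (`N = n` along `e`; plumbing). [folklore] -/
private theorem two_le_rank' (e : Fin N × Fin 1 ≃ Fin n) (hn : 3 ≤ n) : 2 ≤ N := by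
  have := Fintype.card_congr e; simp only [Fintype.card_prod, Fintype.card_fin, mul_one] at this; omega

/-- Item (3) read on a Mathlib `Representation.Equiv` (either direction), the `ε`- and `χ`-clauses: an equivalence
`ω_i ≃ ω_j` of two members forces their Step-1 representatives into one class and their Step-3 characters to agree (generic over the
indexed collection; companion of ✔ `LemD1_3AsPrintedI.mu_eq_of_nonempty_equiv`). [cite: Liu2021, App. D Lemma D.1 (3) (l. 5233)] -/
theorem _root_.Literature.NumberTheory.Automorphic.Liu2021.LemD1_3AsPrintedI.sameClass_and_chi_eq_of_nonempty_equiv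
    {F' E' : Type} [Field F'] [ValuativeRel F'] [TopologicalSpace F'] [CommRing E'] [Algebra F' E'] [TopologicalSpace E']
    [IsTopologicalRing E'] {m : ℕ} {κ : Type} {Lf : LemD1IndexedFamily F' E' m κ} (h3 : LemD1_3AsPrintedI Lf) (hm : 3 ≤ m)
    {i j : κ} (h : Nonempty ((Lf.quot i).Equiv (Lf.quot j))) : LemD1.SameClass (Lf.eps j) (Lf.eps i) ∧ Lf.chi i = Lf.chi j := by
  obtain ⟨f⟩ := h
  exact h3.sameClass_and_chi_eq_of_areIsomorphicRep hm
    ⟨f.toLinearEquiv, fun g v => by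
      rw [Representation.Equiv.toLinearEquiv_apply, Representation.Equiv.toLinearEquiv_apply]
      exact f.toIntertwiningMap.isIntertwining _ _ g v⟩

/-- **Lemma D.1 (3) AS PRINTED, read on the indexed family at `v`, in LOCAL-TYPE currency — the `ε`- and `χ`-clauses**: an equivalence of
the local types `X_v(𝓢_i, a_i, χ_i) ≃ X_v(𝓢_j, a_j, χ_j)` of `U(J_V)(F_v)` forces the Step-1 representatives of `⟨a_j⟩`, `⟨a_i⟩` to lie in one
class AND the Step-3 characters to agree (through `quotEquivLocalType` and `LemD1_3AsPrintedI.sameClass_and_chi_eq_of_areIsomorphicRep`; the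
`μ`-clause is ✔ `localMu_eq_of_nonempty_equiv_localTypes`). [cite: Liu2021, App. D Lemma D.1 (3) (l. 5233)] -/
theorem sameClass_and_chi_eq_of_nonempty_equiv_localTypes (hV : TV.IsSymm) (hVd : IsUnit TV.det)
    (hJV : JV = TV.map (algebraMap F E))
    (hn : 3 ≤ n) {ι : Type} (aOf : ι → Fˣ) (χOf : ι → Chi F E c)
    (𝓢Of : ∀ i, LocalSplitting.FinLocalSplittings F E c n hcδ hδ hd (gram F e TV (TW F (aOf i))) (isSymm_gram F e hV (isSymm_TW F (aOf i)))
      (reindex_kronecker_eq_gram_map F E e hJV (JW_eq F E (aOf i))))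
    (μOf : ι → ∀ v : HeightOneSpectrum (𝓞 F), (LocalRing E v)ˣ →* ℂˣ) (hμn : ∀ i v x, ‖((μOf i v x : ℂˣ) : ℂ)‖ = 1)
    (hμc : ∀ i v, Continuous fun x => ((μOf i v x : ℂˣ) : ℂ))
    (hμF : ∀ (i : ι) (v : HeightOneSpectrum (𝓞 F)) (t : (v.adicCompletion F)ˣ),
      μOf i v (Units.map (algebraMap (v.adicCompletion F) (LocalRing E v)).toMonoidHom t) = 1 ↔
        ∃ x : (LocalRing E v)ˣ, (x : LocalRing E v) * conjLocal E c v x = algebraMap (v.adicCompletion F) (LocalRing E v) t)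
    (hD3 : ∀ v, LemD1_3AsPrintedI (localIndexedFamilyAtV F E c N e JV hcδ hδ hd hV hVd hJV hn aOf χOf 𝓢Of μOf hμn hμc hμF v))
    (v : HeightOneSpectrum (𝓞 F)) (i j : ι)
    (h : Nonempty ((show Representation ℂ (UnitaryGroup.localPi E c N JV v) _ from
        (TwistedCoinv.rep (localCharOfCenter F E c (JW F E (aOf i)) (JW_apply_ne_zero F E (aOf i)) (χOf i).1 v) ((𝓢Of i).omegaLoc v)
          (commute_omegaLoc_localCenter F E c N e JV (JW F E (aOf i)) hcδ hδ hd hV (isSymm_TW F (aOf i)) hJV (JW_eq F E (aOf i))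
            (JW_apply_ne_zero F E (aOf i)) (𝓢Of i) v)).comp (UnitaryGroup.localLineInl E c N e JV (JW F E (aOf i)) v)).Equiv
      (show Representation ℂ (UnitaryGroup.localPi E c N JV v) _ from
        (TwistedCoinv.rep (localCharOfCenter F E c (JW F E (aOf j)) (JW_apply_ne_zero F E (aOf j)) (χOf j).1 v) ((𝓢Of j).omegaLoc v)
          (commute_omegaLoc_localCenter F E c N e JV (JW F E (aOf j)) hcδ hδ hd hV (isSymm_TW F (aOf j)) hJV (JW_eq F E (aOf j))
            (JW_apply_ne_zero F E (aOf j)) (𝓢Of j) v)).comp (UnitaryGroup.localLineInl E c N e JV (JW F E (aOf j)) v)))) :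
    LemD1.SameClass ((localIndexedFamilyAtV F E c N e JV hcδ hδ hd hV hVd hJV hn aOf χOf 𝓢Of μOf hμn hμc hμF v).eps j)
        ((localIndexedFamilyAtV F E c N e JV hcδ hδ hd hV hVd hJV hn aOf χOf 𝓢Of μOf hμn hμc hμF v).eps i) ∧
      (localIndexedFamilyAtV F E c N e JV hcδ hδ hd hV hVd hJV hn aOf χOf 𝓢Of μOf hμn hμc hμF v).chi i =
        (localIndexedFamilyAtV F E c N e JV hcδ hδ hd hV hVd hJV hn aOf χOf 𝓢Of μOf hμn hμc hμF v).chi j := by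
  obtain ⟨eqv⟩ := h
  -- `quot i ≃ X_i ∘ uEquiv ≃ X_j ∘ uEquiv ≃ quot j` (the middle step: `eqv` read on `S.U` along `uEquiv`), as in the `μ`-clause
  exact (hD3 v).sameClass_and_chi_eq_of_nonempty_equiv (three_le_rank' N e hn) (i := i) (j := j)
    ⟨((quotEquivLocalType F E c N e JV hcδ hδ hd hV hVd hJV (aOf i) (𝓢Of i) hn (μOf i) (hμn i) (hμc i) (hμF i) (χOf i) v).trans
      (Representation.Equiv.mk eqv.toLinearEquiv fun u => by
        rw [Representation.Equiv.toLinearEquiv_toLinearMap]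
        exact eqv.isIntertwining' _)).trans
      (quotEquivLocalType F E c N e JV hcδ hδ hd hV hVd hJV (aOf j) (𝓢Of j) hn (μOf j) (hμn j) (hμc j) (hμF j) (χOf j) v).symm⟩

/-- **THE `ε`-LEG OF `hsep` from [Liu2021, App. D Lem. D.1 (1), (3)] AS PRINTED read on the INDEXED FAMILY** (the sibling of
✔ `forall_localMu_eq_of_equiv_of_lemD1AsPrintedAtV`): a `G`-equivariant linear equivalence `ω(s_i, a_i, χ_i) ≃ ω(s_j, a_j, χ_j)` with
`ω(s_i, a_i, χ_i) ≠ 0` forces EQUAL COLLECTIONS `locF a_i = locF a_j` — restriction to `U(J_V)(F_v)` (Flath uniqueness, irreducible local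
types from Lem. D.1 (1)), the class clause of Lem. D.1 (3) at every `v`, then §1.
[cite: Liu2021, Def. 4.11 (l. 2088, 2092–2096), Def. 4.12 (l. 2105), Thm. 4.18 (2) with proof l. 2270, App. D Lem. D.1 (1), (3) (l. 5229, 5233)] [cite: FlathCorvallis1979, Theorem 3 (uniqueness clause)] -/
theorem locF_eq_of_equiv_of_lemD1AsPrintedAtV (hV : TV.IsSymm) (hVd : IsUnit TV.det)
    (hJV : JV = TV.map (algebraMap F E))
    (hn : 3 ≤ n) {ι : Type} (aOf : ι → Fˣ) (χOf : ι → Chi F E c)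
    (𝓢Of : ∀ i, LocalSplitting.FinLocalSplittings F E c n hcδ hδ hd (gram F e TV (TW F (aOf i))) (isSymm_gram F e hV (isSymm_TW F (aOf i)))
      (reindex_kronecker_eq_gram_map F E e hJV (JW_eq F E (aOf i))))
    (μOf : ι → ∀ v : HeightOneSpectrum (𝓞 F), (LocalRing E v)ˣ →* ℂˣ) (hμn : ∀ i v x, ‖((μOf i v x : ℂˣ) : ℂ)‖ = 1)
    (hμc : ∀ i v, Continuous fun x => ((μOf i v x : ℂˣ) : ℂ))
    (hμF : ∀ (i : ι) (v : HeightOneSpectrum (𝓞 F)) (t : (v.adicCompletion F)ˣ),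
      μOf i v (Units.map (algebraMap (v.adicCompletion F) (LocalRing E v)).toMonoidHom t) = 1 ↔
        ∃ x : (LocalRing E v)ˣ, (x : LocalRing E v) * conjLocal E c v x = algebraMap (v.adicCompletion F) (LocalRing E v) t)
    {sOf : ∀ (i : ι) (a : Fˣ), UnitaryGroup.adelicPair F E c N 1 JV (JW F E a) →* adelicMpCont F (Fin n) (adelicGram F e TV (TW F a))}
    (hsOf : ∀ (i : ι) (a : Fˣ), (splittingDatum F E c N 1 e JV (JW F E a) hcδ hδ hd hV (isSymm_TW F a) hVd (isUnit_det_TW F a) hJV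
      (JW_eq F E a)).IsCompatible (sOf i a))
    (hfacOf : ∀ i, (pairSmall₁ F E c N 1 e JV (JW F E (aOf i)) (sOf i (aOf i))).comp (finPairToAdelic F E c N 1 JV (JW F E (aOf i))) =
      localRefSection F E c N 1 e JV (JW F E (aOf i)) hcδ hδ hd hV (isSymm_TW F (aOf i)) hJV (JW_eq F E (aOf i)) (𝓢Of i))
    (hD3 : ∀ v, LemD1_3AsPrintedI (localIndexedFamilyAtV F E c N e JV hcδ hδ hd hV hVd hJV hn aOf χOf 𝓢Of μOf hμn hμc hμF v))
    {G : Type*} [Group G] {ι' : G →* UnitaryGroup.finAdelic F E c N JV} (hι : Function.Surjective ι')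
    (hD1V : ∀ v, (localIndexedFamilyAtV F E c N e JV hcδ hδ hd hV hVd hJV hn aOf χOf 𝓢Of μOf hμn hμc hμF v).Item1AsPrinted) (i j : ι)
    (hnt : Nontrivial (omegaAtLine F E c N e JV hcδ hδ hd hV hVd hJV (hsOf i) (aOf i) (χOf i)))
    (hst : ∃ f : omegaAtLine F E c N e JV hcδ hδ hd hV hVd hJV (hsOf i) (aOf i) (χOf i) ≃ₗ[ℂ]
        omegaAtLine F E c N e JV hcδ hδ hd hV hVd hJV (hsOf j) (aOf j) (χOf j),
      ∀ (g : G) (x : omegaAtLine F E c N e JV hcδ hδ hd hV hVd hJV (hsOf i) (aOf i) (χOf i)),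
        f (rhoAtLine F E c N e JV hcδ hδ hd hV hVd hJV (hsOf i) ι' (aOf i) (χOf i) g x) =
          rhoAtLine F E c N e JV hcδ hδ hd hV hVd hJV (hsOf j) ι' (aOf j) (χOf j) g (f x)) :
    locF F d (aOf i) = locF F d (aOf j) ∧ χOf i = χOf j := by
  haveI := hnt
  obtain ⟨Eq⟩ := nonempty_equivId_of_equiv F E c N e JV hcδ hδ hd hV hVd hJV (hsOf i) (hsOf j) (aOf i) (aOf j) (χOf i) (χOf j) hι hst
  -- at every place: irreducible local types, their equivalence, the two clauses of Lemma D.1 (3)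
  have hloc : ∀ v : HeightOneSpectrum (𝓞 F),
      LemD1.SameClass ((localIndexedFamilyAtV F E c N e JV hcδ hδ hd hV hVd hJV hn aOf χOf 𝓢Of μOf hμn hμc hμF v).eps j)
          ((localIndexedFamilyAtV F E c N e JV hcδ hδ hd hV hVd hJV hn aOf χOf 𝓢Of μOf hμn hμc hμF v).eps i) ∧
        (localIndexedFamilyAtV F E c N e JV hcδ hδ hd hV hVd hJV hn aOf χOf 𝓢Of μOf hμn hμc hμF v).chi i =
          (localIndexedFamilyAtV F E c N e JV hcδ hδ hd hV hVd hJV hn aOf χOf 𝓢Of μOf hμn hμc hμF v).chi j := fun v => by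
    haveI := isIrreducible_localType_of_lemD1AsPrintedAtV F E c N e JV hcδ hδ hd hV hVd hJV (aOf i) (𝓢Of i) hn (μOf i) (hμn i) (hμc i)
      (hμF i) (χOf i) v (hD1V v i)
    haveI := isIrreducible_localType_of_lemD1AsPrintedAtV F E c N e JV hcδ hδ hd hV hVd hJV (aOf j) (𝓢Of j) hn (μOf j) (hμn j) (hμc j)
      (hμF j) (χOf j) v (hD1V v j)
    exact sameClass_and_chi_eq_of_nonempty_equiv_localTypes F E c N JV hcδ hδ e hd hV hVd hJV hn aOf χOf 𝓢Of μOf hμn hμc hμF hD3 v i j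
      (nonempty_equiv_localTypes_of_equivId_of_isIrreducible F E c N e JV hcδ hδ hd hV hVd hJV (hsOf i) (hsOf j) (aOf i) (χOf i) (𝓢Of i)
        (aOf j) (χOf j) (𝓢Of j) (hfacOf i) (hfacOf j) hn Eq v)
  refine ⟨?_, ?_⟩
  · -- the `ε`-leg: §1 at every `v`, read backwards
    exact (locF_eq_of_forall_sameClass_epsLine F E c N JV hcδ hδ hd (two_le_rank' N e hn) (transpose_map_conj_JV F E c N JV hV hJV)
      (det_JV_ne_zero F E N JV hVd hJV) (aOf j) (aOf i) fun v => (hloc v).1).symm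
  · -- the `χ`-leg: §2, the local equality of `χ ∘ θ` read off `chi i = chi j`
    refine chi_eq_of_forall_localCharOfCenter_theta_eq F E c N JV hcδ hδ (two_le_rank' N e hn) (transpose_map_conj_JV F E c N JV hV hJV)
      (det_JV_ne_zero F E N JV hVd hJV) (aOf i) (aOf j) (χOf i) (χOf j) fun v z => ?_
    exact congrArg (fun χ : LemD1.ChiSet _ => χ.1 z) (hloc v).2

/-- **THE `ε`- AND `χ`-LEGS OF `hsep` from [Liu2021, App. D Lem. D.1 (1), (3)] AS PRINTED** — the displayed-row shape (the sibling of
✔ `forall_localMu_eq_of_equiv_of_lemD1AsPrintedI`): Lem. D.1 (1) AS PRINTED at every PAIR datum (`hD1`, the END's `hD1''` row), Lem. D.1 (3) AS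
PRINTED read on `localIndexedFamilyAtV … v` at every `v` (`hD3`), `ι : G →* U(J_V)(𝔸_f)` onto; a `G`-equivariant linear equivalence
`ω(s_i, a_i, χ_i) ≃ ω(s_j, a_j, χ_j)` with `ω(s_i, a_i, χ_i) ≠ 0` forces `locF a_i = locF a_j` AND `χ_i = χ_j`.
[cite: Liu2021, Def. 4.11 (l. 2088–2096), Def. 4.12 (l. 2105), Thm. 4.18 (2) with proof l. 2270, App. D Lem. D.1 (1), (3) (l. 5229, 5233)] [cite: FlathCorvallis1979, Theorem 3 (uniqueness clause)] -/
theorem locF_eq_and_chi_eq_of_equiv_of_lemD1AsPrintedI (hV : TV.IsSymm) (hVd : IsUnit TV.det)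
    (hJV : JV = TV.map (algebraMap F E))
    (hn : 3 ≤ n) {ι : Type} (aOf : ι → Fˣ) (χOf : ι → Chi F E c)
    (𝓢Of : ∀ i, LocalSplitting.FinLocalSplittings F E c n hcδ hδ hd (gram F e TV (TW F (aOf i))) (isSymm_gram F e hV (isSymm_TW F (aOf i)))
      (reindex_kronecker_eq_gram_map F E e hJV (JW_eq F E (aOf i))))
    (μOf : ι → ∀ v : HeightOneSpectrum (𝓞 F), (LocalRing E v)ˣ →* ℂˣ) (hμn : ∀ i v x, ‖((μOf i v x : ℂˣ) : ℂ)‖ = 1)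
    (hμc : ∀ i v, Continuous fun x => ((μOf i v x : ℂˣ) : ℂ))
    (hμF : ∀ (i : ι) (v : HeightOneSpectrum (𝓞 F)) (t : (v.adicCompletion F)ˣ),
      μOf i v (Units.map (algebraMap (v.adicCompletion F) (LocalRing E v)).toMonoidHom t) = 1 ↔
        ∃ x : (LocalRing E v)ˣ, (x : LocalRing E v) * conjLocal E c v x = algebraMap (v.adicCompletion F) (LocalRing E v) t)
    {sOf : ∀ (i : ι) (a : Fˣ), UnitaryGroup.adelicPair F E c N 1 JV (JW F E a) →* adelicMpCont F (Fin n) (adelicGram F e TV (TW F a))}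
    (hsOf : ∀ (i : ι) (a : Fˣ), (splittingDatum F E c N 1 e JV (JW F E a) hcδ hδ hd hV (isSymm_TW F a) hVd (isUnit_det_TW F a) hJV
      (JW_eq F E a)).IsCompatible (sOf i a))
    (hfacOf : ∀ i, (pairSmall₁ F E c N 1 e JV (JW F E (aOf i)) (sOf i (aOf i))).comp (finPairToAdelic F E c N 1 JV (JW F E (aOf i))) =
      localRefSection F E c N 1 e JV (JW F E (aOf i)) hcδ hδ hd hV (isSymm_TW F (aOf i)) hJV (JW_eq F E (aOf i)) (𝓢Of i))
    (hD1 : ∀ i v, LemD1_1AsPrinted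
      (localLemD1Data F E c N e JV hcδ hδ hd hV hVd hJV (aOf i) (𝓢Of i) hn (μOf i) (hμn i) (hμc i) (hμF i) (χOf i).1
        (norm_chi_eq_one F E c (Algebra.IsQuadraticExtension.finrank_eq_two F E)
          (UnitaryGroup.algEquiv_ne_one_of_apply_eq_neg F E c hcδ hδ) (χOf i)) (χOf i).2.1 v))
    (hD3 : ∀ v, LemD1_3AsPrintedI (localIndexedFamilyAtV F E c N e JV hcδ hδ hd hV hVd hJV hn aOf χOf 𝓢Of μOf hμn hμc hμF v))
    {G : Type*} [Group G] {ι' : G →* UnitaryGroup.finAdelic F E c N JV} (hι : Function.Surjective ι') (i j : ι)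
    (hnt : Nontrivial (omegaAtLine F E c N e JV hcδ hδ hd hV hVd hJV (hsOf i) (aOf i) (χOf i)))
    (hst : ∃ f : omegaAtLine F E c N e JV hcδ hδ hd hV hVd hJV (hsOf i) (aOf i) (χOf i) ≃ₗ[ℂ]
        omegaAtLine F E c N e JV hcδ hδ hd hV hVd hJV (hsOf j) (aOf j) (χOf j),
      ∀ (g : G) (x : omegaAtLine F E c N e JV hcδ hδ hd hV hVd hJV (hsOf i) (aOf i) (χOf i)),
        f (rhoAtLine F E c N e JV hcδ hδ hd hV hVd hJV (hsOf i) ι' (aOf i) (χOf i) g x) =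
          rhoAtLine F E c N e JV hcδ hδ hd hV hVd hJV (hsOf j) ι' (aOf j) (χOf j) g (f x)) :
    locF F d (aOf i) = locF F d (aOf j) ∧ χOf i = χOf j := by
  have hloc : ∀ v : HeightOneSpectrum (𝓞 F),
      LemD1.SameClass ((localIndexedFamilyAtV F E c N e JV hcδ hδ hd hV hVd hJV hn aOf χOf 𝓢Of μOf hμn hμc hμF v).eps j)
          ((localIndexedFamilyAtV F E c N e JV hcδ hδ hd hV hVd hJV hn aOf χOf 𝓢Of μOf hμn hμc hμF v).eps i) ∧
        (localIndexedFamilyAtV F E c N e JV hcδ hδ hd hV hVd hJV hn aOf χOf 𝓢Of μOf hμn hμc hμF v).chi i =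
          (localIndexedFamilyAtV F E c N e JV hcδ hδ hd hV hVd hJV hn aOf χOf 𝓢Of μOf hμn hμc hμF v).chi j := fun v =>
    sameClass_and_chi_eq_of_nonempty_equiv_localTypes F E c N JV hcδ hδ e hd hV hVd hJV hn aOf χOf 𝓢Of μOf hμn hμc hμF hD3 v i j
      (nonempty_equiv_localTypes_of_equiv F E c N e JV hcδ hδ hd hV hVd hJV (hsOf i) (hsOf j) (aOf i) (χOf i) (𝓢Of i) (aOf j) (χOf j)
        (𝓢Of j) (hfacOf i) (hfacOf j) hn (μOf i) (hμn i) (hμc i) (hμF i) (μOf j) (hμn j) (hμc j) (hμF j) (hD1 i) (hD1 j) hι hnt hst v)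
  refine ⟨?_, ?_⟩
  · exact (locF_eq_of_forall_sameClass_epsLine F E c N JV hcδ hδ hd (two_le_rank' N e hn) (transpose_map_conj_JV F E c N JV hV hJV)
      (det_JV_ne_zero F E N JV hVd hJV) (aOf j) (aOf i) fun v => (hloc v).1).symm
  · refine chi_eq_of_forall_localCharOfCenter_theta_eq F E c N JV hcδ hδ (two_le_rank' N e hn) (transpose_map_conj_JV F E c N JV hV hJV)
      (det_JV_ne_zero F E N JV hVd hJV) (aOf i) (aOf j) (χOf i) (χOf j) fun v z => ?_
    exact congrArg (fun χ : LemD1.ChiSet _ => χ.1 z) (hloc v).2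

end Indexed

end Literature.NumberTheory.Automorphic.Liu2021.Def411WeilCarriers

end
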